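import Mathlib
import Literature.Probability.LatticeModels.GKSInequalities
import Summits.CriticalPhenomena.Ising3DConformalLimit.Theorems.PrecisionLaplacianInverseMFerromagnetK23PrecisionAux
import HarnessLib

/-!
# Crux `PrecisionLaplacian.InverseMFerromagnet` (stmt-CriticalPhenomena-4798), line `Sketch` —
# stub `helper_K23_precision` (theta-law anchor Θ1: the `K₂,₃` hub–hub precision in closed form)

THEOREM-ONLY file (no definitions).  For the `K₂,₃` pair ferromagnet (hubs `0, 1`, middle sites
`Fin.natAdd 2 i`, branch couplings `b i`, `c i`, series couplings `a i`: `tanh a_i = tanh b_i tanh c_i`)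
the hub–hub entry of the precision matrix `Σ⁻¹` (`Σ_pq = ⟨σ_pσ_q⟩`) is
`(Σ⁻¹)₀₁ = ½ cosh²A (tanh A − ∑_i tanh(A − 2a_i))`, `A = ∑ a_i`.

Proof.  By Callen's identity at the middle sites (`k23_callen`) all entries of `Σ` are explicit in
`ρ = ⟨σ₀σ₁⟩` and `α_i, β_i`: `Σ_{mid i,0} = α_i + β_iρ`, `Σ_{mid i,1} = α_iρ + β_i`,
`Σ_{mid i, mid j} = α_iΣ_{0,mid j} + β_iΣ_{1,mid j}` (`i ≠ j`); with `d_i := 1 − α_i(α_i+β_iρ) − β_i(α_iρ+β_i) > 0`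
the row vector `w = (1/(1−ρ²) + ∑α_i²/d_i, −ρ/(1−ρ²) + ∑α_iβ_i/d_i, −α_i/d_i)` satisfies `wΣ = e₀`
(block/Schur structure of `Σ`), hence is row `0` of `Σ⁻¹` (`Σ ≻ 0`, `c3_posDef`).  Then `ρ = tanh A`
(`k23_rho`), `α_iβ_i/d_i = t_i/(1+t_i²−2ρt_i)` (`k23_alpha_beta`, `t_i = tanh a_i`) and the per-branch
closed form `k23_branch` finish the computation.
-/

namespace Summit.CriticalPhenomena.Ising3DConformalLimit.Cruxes.InverseMFerromagnet.PartialCovarianceLadder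

open Literature.Probability.LatticeModels Finset Matrix

noncomputable section

/-! ## The registered stub -/

/-- **Θ1 · `K₂,₃` hub–hub precision in closed form.**  Sites `Fin 5` (hubs `0`, `1`; mids
`2,3,4 = Fin.natAdd 2 i`), bonds `Fin 3 ⊕ Fin 3` (`inl i = {0, mid i}` with coupling `b i`,
`inr i = {1, mid i}` with coupling `c i`), and `a i` the series coupling of branch `i`
(`tanh a_i = tanh b_i tanh c_i`).  Then `(Σ⁻¹)₀₁ = ½ cosh²(Σ a) · (tanh (Σ a) − Σ_i tanh (Σ a − 2 a_i))`.
Proof: the middle spins are conditionally independent given the hubs with linear conditional means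
`α_i σ₀ + β_i σ₁` (Callen, `k23_callen`), so `Σ = [[Σ_SS, Σ_SS Mᵀ],[M Σ_SS, M Σ_SS Mᵀ + D]]` and row `0`
of `Σ⁻¹` is explicit: `(Σ⁻¹)₀₁ = −ρ/(1−ρ²) + Σ_i α_iβ_i/d_i` with `ρ = ⟨σ₀σ₁⟩ = tanh(Σ a)` (summing out
the middle spins, `k23_rho`), `d_i = 1 − α_i² − β_i² − 2α_iβ_iρ`; finally
`α_iβ_i/d_i = t_i/(1 + t_i² − 2ρt_i)` (`t_i = tanh a_i`, `k23_alpha_beta`) `= ½cosh A sinh A − ½cosh²A tanh(A − 2a_i)`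
(`k23_branch`). [folklore] -/
theorem helper_K23_precision :
    ∀ (b c a : Fin 3 → ℝ), (∀ i, 0 ≤ b i) → (∀ i, 0 ≤ c i) →
      (∀ i, Real.tanh (a i) = Real.tanh (b i) * Real.tanh (c i)) →
      (Matrix.of fun p q : Fin 5 =>
          gksExpect (Finset.univ : Finset (Fin 3 ⊕ Fin 3)) (Sum.elim b c)
            (Sum.elim (fun i : Fin 3 => ({0, Fin.natAdd 2 i} : Finset (Fin 5)))
              (fun i : Fin 3 => ({1, Fin.natAdd 2 i} : Finset (Fin 5))))
            (fun ω => spinAt p ω * spinAt q ω))⁻¹ 0 1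
        = (1 / 2) * Real.cosh (∑ i, a i) ^ 2 *
            (Real.tanh (∑ i, a i) - ∑ i, Real.tanh ((∑ j, a j) - 2 * a i)) := by
  intro b c a _hb _hc habc
  -- the second-moment matrix
  set G : Matrix (Fin 5) (Fin 5) ℝ := Matrix.of fun p q : Fin 5 =>
      gksExpect (Finset.univ : Finset (Fin 3 ⊕ Fin 3)) (Sum.elim b c)
        (Sum.elim (fun i : Fin 3 => ({0, Fin.natAdd 2 i} : Finset (Fin 5)))
          (fun i : Fin 3 => ({1, Fin.natAdd 2 i} : Finset (Fin 5))))
        (fun ω => spinAt p ω * spinAt q ω) with hG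
  have hPD : G.PosDef := c3_posDef _ _ _
  have hsymm : ∀ p q, G p q = G q p := fun p q => by
    simp only [hG, Matrix.of_apply]
    exact congrArg _ (funext fun ω => mul_comm _ _)
  have hdiag : ∀ p, G p p = 1 := fun p => by
    simp only [hG, Matrix.of_apply, spinAt_mul_self]
    exact div_self (gksSum_one_pos _ _ _).ne'
  -- parameters
  obtain ⟨A, hA⟩ : ∃ A : ℝ, A = ∑ i, a i := ⟨_, rfl⟩
  rw [← hA]
  obtain ⟨ρ, hρ⟩ : ∃ ρ : ℝ, ρ = Real.tanh A := ⟨_, rfl⟩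
  obtain ⟨α, hα⟩ : ∃ α : Fin 3 → ℝ, ∀ i, α i = (Real.tanh (b i + c i) + Real.tanh (b i - c i)) / 2 :=
    ⟨fun i => (Real.tanh (b i + c i) + Real.tanh (b i - c i)) / 2, fun _ => rfl⟩
  obtain ⟨β, hβ⟩ : ∃ β : Fin 3 → ℝ, ∀ i, β i = (Real.tanh (b i + c i) - Real.tanh (b i - c i)) / 2 :=
    ⟨fun i => (Real.tanh (b i + c i) - Real.tanh (b i - c i)) / 2, fun _ => rfl⟩
  -- entries of `G`: hubs
  have h10 : G 1 0 = ρ := by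
    rw [hsymm, hρ, hA]
    exact k23_rho b c a habc
  have h01 : G 0 1 = ρ := (hsymm 0 1).trans h10
  -- entries of `G`: Callen at the middle sites
  have hm0 : ∀ i, G (Fin.natAdd 2 i) 0 = α i + β i * ρ := by
    intro i
    have h : G (Fin.natAdd 2 i) 0 = _ * G 0 0 + _ * G 1 0 :=
      k23_callen b c i (spinAt 0) (fun ω => pcm2im_spinAt_flip_ne (k23_mid_ne_zero i).symm ω)
    rw [h, hdiag, h10, hα, hβ]
    ring
  have hm1 : ∀ i, G (Fin.natAdd 2 i) 1 = α i * ρ + β i := by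
    intro i
    have h : G (Fin.natAdd 2 i) 1 = _ * G 0 1 + _ * G 1 1 :=
      k23_callen b c i (spinAt 1) (fun ω => pcm2im_spinAt_flip_ne (k23_mid_ne_one i).symm ω)
    rw [h, hdiag, h01, hα, hβ]
    ring
  have hmm : ∀ i j, i ≠ j →
      G (Fin.natAdd 2 i) (Fin.natAdd 2 j) = α i * (α j + β j * ρ) + β i * (α j * ρ + β j) := by
    intro i j hij
    have h : G (Fin.natAdd 2 i) (Fin.natAdd 2 j) = _ * G 0 (Fin.natAdd 2 j) + _ * G 1 (Fin.natAdd 2 j) :=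
      k23_callen b c i (spinAt (Fin.natAdd 2 j))
        (fun ω => pcm2im_spinAt_flip_ne (fun h => hij ((Fin.natAdd_inj 2).1 h).symm) ω)
    rw [h, hsymm 0, hm0, hsymm 1, hm1, hα i, hβ i]
  -- nondegeneracy
  have hρlt : ρ < 1 := hρ ▸ Real.tanh_lt_one A
  have hρgt : -1 < ρ := hρ ▸ Real.neg_one_lt_tanh A
  have h1ρ : 1 - ρ ^ 2 ≠ 0 := by nlinarith
  obtain ⟨d, hd⟩ : ∃ d : Fin 3 → ℝ, ∀ i, d i = 1 - α i * (α i + β i * ρ) - β i * (α i * ρ + β i) :=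
    ⟨fun i => 1 - α i * (α i + β i * ρ) - β i * (α i * ρ + β i), fun _ => rfl⟩
  have hdpos : ∀ i, 0 < d i := by
    intro i
    have e : d i = ((1 - Real.tanh (b i + c i) ^ 2) * (1 + ρ)
        + (1 - Real.tanh (b i - c i) ^ 2) * (1 - ρ)) / 2 := by
      rw [hd, hα, hβ]
      ring
    rw [e]
    have h1 := Real.tanh_sq_lt_one (b i + c i)
    have h2 := Real.tanh_sq_lt_one (b i - c i)
    have h3 : 0 < (1 - Real.tanh (b i + c i) ^ 2) * (1 + ρ) := mul_pos (by linarith) (by linarith)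
    have h4 : 0 < (1 - Real.tanh (b i - c i) ^ 2) * (1 - ρ) := mul_pos (by linarith) (by linarith)
    linarith
  -- the explicit row `0` of `G⁻¹`
  obtain ⟨w, hw⟩ : ∃ w : Fin 5 → ℝ, w = ![1 / (1 - ρ ^ 2) + ∑ i, α i ^ 2 / d i,
      -ρ / (1 - ρ ^ 2) + ∑ i, α i * β i / d i, -α 0 / d 0, -α 1 / d 1, -α 2 / d 2] := ⟨_, rfl⟩
  have hw0 : w 0 = 1 / (1 - ρ ^ 2) + ∑ i, α i ^ 2 / d i := by
    rw [hw]
    rfl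
  have hw1 : w 1 = -ρ / (1 - ρ ^ 2) + ∑ i, α i * β i / d i := by
    rw [hw]
    rfl
  have hwm : ∀ i : Fin 3, w (Fin.natAdd 2 i) = -α i / d i := by
    intro i
    rw [hw]
    fin_cases i <;> rfl
  have hsplit : ∀ f : Fin 5 → ℝ, ∑ p, f p = f 0 + f 1 + ∑ i : Fin 3, f (Fin.natAdd 2 i) := by
    intro f
    rw [Fin.sum_univ_five, Fin.sum_univ_three]
    show f 0 + f 1 + f 2 + f 3 + f 4 = f 0 + f 1 + (f 2 + f 3 + f 4)
    ring
  have hr0 : ∀ i, w (Fin.natAdd 2 i) * G (Fin.natAdd 2 i) 0 = -α i / d i * (α i + β i * ρ) := by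
    intro i
    rw [hwm, hm0]
  have hr1 : ∀ i, w (Fin.natAdd 2 i) * G (Fin.natAdd 2 i) 1 = -α i / d i * (α i * ρ + β i) := by
    intro i
    rw [hwm, hm1]
  have hrm : ∀ i j, w (Fin.natAdd 2 i) * G (Fin.natAdd 2 i) (Fin.natAdd 2 j)
      = -α i / d i * (α i * (α j + β j * ρ) + β i * (α j * ρ + β j)) + if i = j then -α j else 0 := by
    intro i j
    rw [hwm]
    by_cases hij : i = j
    · subst hij
      rw [if_pos rfl, hdiag]
      have e : (1 : ℝ) = α i * (α i + β i * ρ) + β i * (α i * ρ + β i) + d i := by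
        rw [hd]
        ring
      rw [e, mul_add, div_mul_cancel₀ _ (hdpos i).ne']
    · rw [if_neg hij, hmm i j hij, add_zero]
  have hvec : w ᵥ* G = Pi.single 0 1 := by
    funext q
    simp only [Matrix.vecMul, dotProduct]
    rw [hsplit]
    obtain hq | hq | ⟨j, hq⟩ : q = 0 ∨ q = 1 ∨ ∃ j : Fin 3, q = Fin.natAdd 2 j := by
      fin_cases q
      · exact Or.inl rfl
      · exact Or.inr (Or.inl rfl)
      · exact Or.inr (Or.inr ⟨0, rfl⟩)
      · exact Or.inr (Or.inr ⟨1, rfl⟩)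
      · exact Or.inr (Or.inr ⟨2, rfl⟩)
    · subst hq
      rw [Pi.single_eq_same, Finset.sum_congr rfl fun i _ => hr0 i, hw0, hw1, hdiag, h10]
      have hS : (∑ i, α i ^ 2 / d i) * 1 + (∑ i, α i * β i / d i) * ρ
          + ∑ i, -α i / d i * (α i + β i * ρ) = 0 := by
        rw [Finset.sum_mul, Finset.sum_mul, ← Finset.sum_add_distrib, ← Finset.sum_add_distrib]
        exact Finset.sum_eq_zero fun i _ => by ring
      have hX : 1 / (1 - ρ ^ 2) * 1 + -ρ / (1 - ρ ^ 2) * ρ = 1 := by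
        field_simp
        ring
      linear_combination hS + hX
    · subst hq
      rw [Pi.single_eq_of_ne (by decide : (1 : Fin 5) ≠ 0), Finset.sum_congr rfl fun i _ => hr1 i, hw0,
        hw1, hdiag, h01]
      have hS : (∑ i, α i ^ 2 / d i) * ρ + (∑ i, α i * β i / d i) * 1
          + ∑ i, -α i / d i * (α i * ρ + β i) = 0 := by
        rw [Finset.sum_mul, Finset.sum_mul, ← Finset.sum_add_distrib, ← Finset.sum_add_distrib]
        exact Finset.sum_eq_zero fun i _ => by ring
      have hX : 1 / (1 - ρ ^ 2) * ρ + -ρ / (1 - ρ ^ 2) * 1 = 0 := by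
        field_simp
        ring
      linear_combination hS + hX
    · subst hq
      rw [Pi.single_eq_of_ne (k23_mid_ne_zero j), Finset.sum_congr rfl fun i _ => hrm i j,
        Finset.sum_add_distrib, Finset.sum_ite_eq' Finset.univ j, if_pos (Finset.mem_univ j), hw0, hw1,
        hsymm 0 (Fin.natAdd 2 j), hm0, hsymm 1 (Fin.natAdd 2 j), hm1]
      have hS : (∑ i, α i ^ 2 / d i) * (α j + β j * ρ) + (∑ i, α i * β i / d i) * (α j * ρ + β j)
          + ∑ i, -α i / d i * (α i * (α j + β j * ρ) + β i * (α j * ρ + β j)) = 0 := by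
        rw [Finset.sum_mul, Finset.sum_mul, ← Finset.sum_add_distrib, ← Finset.sum_add_distrib]
        exact Finset.sum_eq_zero fun i _ => by ring
      have hX : 1 / (1 - ρ ^ 2) * (α j + β j * ρ) + -ρ / (1 - ρ ^ 2) * (α j * ρ + β j) + -α j = 0 := by
        field_simp
        ring
      linear_combination hS + hX
  -- hence row `0` of `G⁻¹` is `w`
  have hdet : IsUnit G.det := (Matrix.isUnit_iff_isUnit_det G).mp hPD.isUnit
  have hrow : w = fun q => G⁻¹ 0 q := by
    calc w = (w ᵥ* G) ᵥ* G⁻¹ := by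
          rw [Matrix.vecMul_vecMul, Matrix.mul_nonsing_inv G hdet, Matrix.vecMul_one]
      _ = fun q => G⁻¹ 0 q := by
          rw [hvec, Matrix.single_one_vecMul]
          rfl
  have hentry : G⁻¹ 0 1 = -ρ / (1 - ρ ^ 2) + ∑ i, α i * β i / d i := by
    rw [← hw1, hrow]
  -- closing algebra
  rw [hentry]
  have hbr : ∀ i, α i * β i / d i
      = 1 / 2 * Real.cosh A * Real.sinh A - 1 / 2 * Real.cosh A ^ 2 * Real.tanh (A - 2 * a i) := by
    intro i
    rw [← k23_branch (a i) A, ← hρ]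
    have hD : 1 + Real.tanh (a i) ^ 2 - 2 * ρ * Real.tanh (a i) ≠ 0 := by
      have h : 0 < 1 + Real.tanh (a i) ^ 2 - 2 * ρ * Real.tanh (a i) := by
        nlinarith [sq_nonneg (Real.tanh (a i) - ρ)]
      exact h.ne'
    rw [div_eq_div_iff (hdpos i).ne' hD, habc i, hd i]
    linear_combination k23_alpha_beta (b i) (c i) (α i) (β i) (hα i) (hβ i)
  simp_rw [hbr]
  rw [Finset.sum_sub_distrib, Finset.sum_const, Finset.card_univ, Fintype.card_fin, nsmul_eq_mul,
    ← Finset.mul_sum]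
  have hcA : Real.cosh A ≠ 0 := (Real.cosh_pos A).ne'
  have e1 : -ρ / (1 - ρ ^ 2) = -(Real.sinh A * Real.cosh A) := by
    have hsq := Real.cosh_sq A
    rw [hρ, Real.tanh_eq_sinh_div_cosh, div_pow,
      show 1 - Real.sinh A ^ 2 / Real.cosh A ^ 2 = 1 / Real.cosh A ^ 2 by
        field_simp
        linarith]
    field_simp
  rw [e1, Real.tanh_eq_sinh_div_cosh A]
  push_cast
  field_simp
  ring

end

end Summit.CriticalPhenomena.Ising3DConformalLimit.Cruxes.InverseMFerromagnet.PartialCovarianceLadder
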